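import Literature.AnabelianGeometry.AbsoluteAnabelian.AbsTopII.BelyiCuspidalizationContent

/-!
# [AbsTopII] Cor 3.7′ ⟹ Cor 3.7 (PROOF-ONLY companion of `BelyiCuspidalizationContent.lean`)

S. Mochizuki, *Topics in Absolute Anabelian Geometry II* [AbsTopII] (bib `MochizukiAbsTopII2013`,
kurims manuscript `paper:url-585b8d0ad0d9`), §3 Cor 3.7 pp. 72–73; [AbsTopI] Def 4.2 (iii) p. 50.

No definition.  PROVED: `ChainGroup.IsDeCuspVia.isElemOp` (an exposed • operation homomorphism
witnesses abc-iut-L4-t4's `IsElemOp C .deCusp`) and its converse;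
`BelyiCuspidalization.RealizesChain.hasTerminalChainOfType` (the content conjunct refines the recorded
chain clause of `CuspidalizationChains.lean`); `BelyiModel.cor_3_7_of_cor_3_7′` (the repaired predicate
`BelyiModel.Cor_3_7′` implies the recorded `BelyiModel.Cor_3_7`, p407799 — finding F-f064-1, abc-iut
row «F-f064-1-REPAIR», abc-iut-L4-lead RULING #5w (1)).  Typed ≠ proved; nothing here bears on
[IUTchIII] Cor 3.12.
-/

open CategoryTheory Topology

universe u

namespace Literature.AnabelianGeometry.AbsoluteAnabelian

open Literature.AlgebraicGeometry.Frobenioids (IsSlimGroup)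

namespace FundamentalExtension.ChainGroup

variable {E : FundamentalExtension.{u}} {C : CuspidalData E} {L L' : E.ChainGroup}

/-- An operation homomorphism of type • witnesses t4's elementary operation of type •.
[cite: MochizukiAbsTopI2012, Def 4.2 (iii) p.50] -/
theorem IsDeCuspVia.isElemOp {φ : L.grp →ₜ* L'.grp} (h : IsDeCuspVia C L L' φ) :
    IsElemOp C .deCusp L L' :=
  ⟨φ, h⟩

/-- Conversely, an elementary operation of type • has SOME operation homomorphism of type •.
[cite: MochizukiAbsTopI2012, Def 4.2 (iii) p.50] -/
theorem exists_isDeCuspVia_of_isElemOp (h : IsElemOp C .deCusp L L') :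
    ∃ φ : L.grp →ₜ* L'.grp, IsDeCuspVia C L L' φ :=
  h

end FundamentalExtension.ChainGroup

namespace AbsTopII

open FundamentalExtension
open AbsTopI (ConstructionDataClass)

namespace BelyiCuspidalization

variable {E : FundamentalExtension.{u}} {B : BelyiCuspidalization E} {C : CuspidalData E}
  {hP : IsSlimGroup E.arith} {hΔ : IsSlimGroup E.geom} {hne : E.geom ≠ ⊥}

/-- `RealizesChain` refines the recorded chain clause `HasTerminalChainOfType … B.typeChain B.PiV`
(same chain, same terminal isomorphism, the second-to-last term `Π_t ≅ Π_V` over `G`).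
[cite: MochizukiAbsTopII2013, Cor 3.7 (a) p.73] -/
theorem RealizesChain.hasTerminalChainOfType (h : B.RealizesChain C hP hΔ hne) :
    HasTerminalChainOfType C hP hΔ hne B.typeChain B.PiV := by
  obtain ⟨c, htype, hiso, s, t, -, ht, -, eV, -, gV, -, -, heV, -⟩ := h
  exact ⟨c, htype, hiso, t, ht, eV, gV, heV⟩

/-- **The repair bites** (certificate shape of F-f064-1): if the recorded •-tail is EMPTY
(`n + m = 0`, as for the identity-chain witness `Π ⇝ Π ⇝ Π ⇝ Π ⇝ Π` of type `⋏, ⋎, ⋏, ⋎` behind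
`cor_3_7_of_isSlimGroup_cuspOf_geom`), then `RealizesChain` forces the output's `Π_U ↠ Π_V` to be
INJECTIVE — so an output whose `Π_U ↠ Π_V` has non-trivial kernel (points actually removed) realizes
no chain with an empty •-tail. [cite: MochizukiAbsTopII2013, Cor 3.7 (a) p.73] -/
theorem RealizesChain.projU_injective_of_tail_eq_zero (h : B.RealizesChain C hP hΔ hne)
    (h0 : B.chainParams.2.1 + B.chainParams.2.2 = 0) : Function.Injective B.projU.arith := by
  obtain ⟨c, -, -, s, t, hst, -, eU, eV, -, -, ψ, -, -, hψs, -, hψt⟩ := h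
  have hst' : s = t := Fin.ext (by omega)
  subst hst'
  intro x y hxy
  have hx := hψt x
  have hy := hψt y
  rw [hψs] at hx hy
  have : eV.symm (eU x) = eV.symm (eU y) := Subtype.ext (by rw [hx, hy, hxy])
  exact eU.injective (eV.symm.injective this)

end BelyiCuspidalization

namespace BelyiModel

variable {𝒟 : ConstructionDataClass.{u}} {M : BelyiModel 𝒟}

/-- **Cor 3.7′ ⟹ Cor 3.7**: the repaired predicate (content of (a)) implies the recorded one
(`BelyiModel.Cor_3_7`, p407799): same output, same chain. [cite: MochizukiAbsTopII2013, Cor 3.7 pp.72-73] -/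
theorem cor_3_7_of_cor_3_7' (h : M.Cor_3_7') : M.Cor_3_7 := by
  intro hfull hGC b X hX U
  obtain ⟨B, hiso, hdec, hchain⟩ := h hfull hGC b X hX U
  exact ⟨B, hiso, hdec, hchain.hasTerminalChainOfType⟩

end BelyiModel

end AbsTopII

end Literature.AnabelianGeometry.AbsoluteAnabelian
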